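import Literature.Geometry.Kaehler.ComplexTorusInvertibleIdealQuotients
import Literature.Geometry.Kaehler.ComplexTorusMaximalOrderQuotient
import Literature.Geometry.Kaehler.ComplexTorusSimpleEndomorphismAlgebra
import HarnessLib

/-!
# Ideals of `End(X)` which are lattices: full rank ⟺ containing an isogeny (Kieffer 2024 §1.4.1, standing
# convention — torus level)

For a complex torus `X = ComplexTorus Φ` (`End(X) = endRingInt Φ ⊆ M_ι(ℤ)`, `End⁰(X) = endAlgRat Φ ⊆ M_ι(ℚ)`)
and a left ideal `I ⊆ End(X)` we formalize the convention under which Kieffer's §1.4 (kernel ideals,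
`H(I)`, the isogenies `φ_I : X → X/H(I)` — `ComplexTorusKernelIdeals`, `…KernelIdealRightOrder`,
`…IdealIsogenyComposition`, `…KernelIdealEquivalence`, `…MaximalOrderQuotient`, `…InvertibleIdealQuotients`)
is written:

> "Note that throughout, we are manipulating lattices (with extra structure) in finite-dimensional vector
> spaces over `ℚ` (namely endomorphism rings and ideals, seen inside the endomorphism algebra.) […]
> Throughout, when we say that `I` is an ideal in `End(A)`, we mean that `I` is a *left* ideal (in case
> `End(A)` is not commutative) and we assume that `I` is also a lattice in `End(A)` (i.e. it has full rank
> over `ℤ`). This is equivalent to requiring that `I` contains an isogeny. When `A` is simple, this just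
> means `I ≠ {0}`. **Definition 1.4.1.** […] `H(I) = ⋂_{α ∈ I} ker(α)` […] it is a finite subgroup scheme
> of `A`." [Kieffer2024IsogenyGraphs, §1.4.1, p. 43]

**Lean rendering.**  "`I` is a lattice in `End(A)`" is stated with the tree's notion of a full `ℤ`-lattice of
the `ℚ`-algebra `End⁰(X)`, `Literature.NumberTheory.Automorphic.IsFullLattice (endAlgRat Φ) M` (`M` finitely
generated with `ℚ · M = End⁰(X)`, `JordanZassenhaus`), applied to the image `idealSubmodule Φ I ⊆ End⁰(X)` of
`I` under `End(X) ↪ End⁰(X)` (`endToEndAlgRat`, `endSubmodule` of `ComplexTorusMaximalOrderQuotient`).  Since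
`End(X)` is itself a full lattice (`isFullLattice_endSubmodule`), `I` is a lattice iff it contains a non-zero
INTEGER `d = d · 1_X`, iff it contains an isogeny `α` (then it contains its exponent `e = g ∘ α`, `g` the
quasi-inverse of Prop. 1.1.15, `IsIsogeny.exists_quasiInverse`); for `X` simple every non-zero endomorphism
is an isogeny (`IsSimple.isIsogeny_of_ne_zero`).  Consequences recorded: `H(I)` is finite for a lattice `I`
(the "finite subgroup scheme" of Def. 1.4.1); a kernel ideal is a lattice iff `H(I)` is finite
(`#H(I) · 1_X ∈ I(H(I))`); invertible ideals (`IsInvertibleIdeal`) and the ideals `End(X)α` of isogenies are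
lattices.

## Contents (namespace `Literature.Geometry.Kaehler.ComplexTorus`)

* §1 `idealSubmodule Φ I` (`I ⊆ End(X) ⊆ End⁰(X)` as a `ℤ`-submodule), `mem_idealSubmodule_iff`,
  `endToEndAlgRat_mem_idealSubmodule_iff`, `coe_mem_idealRat_iff_mem_idealSubmodule`, `idealSubmodule_mono`,
  `idealSubmodule_top`, `fg_idealSubmodule`, `mul_mem_idealSubmodule`.
* §2 `exists_intCast_mem_of_mem` (an ideal containing an isogeny contains its exponent),
  `exists_intCast_mem_iff`.
* §3 **`isFullLattice_idealSubmodule_iff`** ("`I` is a lattice ⟺ `I` contains an isogeny"),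
  **`isFullLattice_idealSubmodule_iff_ne_bot`** ("When `A` is simple, this just means `I ≠ {0}`"),
  `isFullLattice_idealSubmodule_mono`, **`finite_kernelSubgroup_of_isFullLattice`** (`H(I)` is finite).
* §4 `natCard_mem_idealOfSubgroup` (`#K · 1_X ∈ I(K)`), `isFullLattice_idealSubmodule_idealOfSubgroup`,
  **`IsKernelIdeal.isFullLattice_idealSubmodule_iff_finite`**, `isFullLattice_idealSubmodule_top`,
  `isFullLattice_idealSubmodule_span_singleton`, `IsInvertibleIdeal.isFullLattice_idealSubmodule`.

No named facts are introduced (one definition with body and proved theorems only).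

## References

* [Kieffer2024IsogenyGraphs] J. Kieffer, *Isogeny graphs in higher dimensions* (lecture notes, 2024), §1.4.1,
  standing convention before Definition 1.4.1 and Def. 1.4.1 (p. 43).
* [Lange2023AbelianVarietiesComplex] H. Lange, *Abelian Varieties over the Complex Numbers*, Springer 2023,
  §1.1.2 Prop. 1.1.15 (quasi-inverse `g` of an isogeny `f` of exponent `e`: `g f = e_X`), Prop. 1.1.8
  (`End(X) ≅ ℤ^m`); §2.4.4 Cor. 2.4.26 (simple tori: non-zero endomorphisms are isogenies).
-/

noncomputable section

open Module Function
open scoped Matrix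
open Literature.NumberTheory.Automorphic

namespace Literature.Geometry.Kaehler

namespace ComplexTorus

variable {ι : Type*} [Fintype ι] [DecidableEq ι] {E : Type*} [NormedAddCommGroup E] [NormedSpace ℂ E]
  (Φ : (ι → ℝ) ≃L[ℝ] E)

/-! ## Casts (plumbing) -/

omit [DecidableEq ι] in
/-- Entrywise cast `ℤ → ℚ` of a product. [folklore] -/
private theorem map_intCast_mul_rat_aux5 (A B : Matrix ι ι ℤ) :
    (A * B).map (Int.cast : ℤ → ℚ) = A.map (Int.cast : ℤ → ℚ) * B.map (Int.cast : ℤ → ℚ) :=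
  Matrix.map_mul (f := Int.castRingHom ℚ)

/-- Coercion of an integer multiple in `End⁰(X)`: `↑(n • M) = n • ↑M`. [folklore] -/
private theorem coe_zsmul_endAlgRat_aux5 (n : ℤ) (M : endAlgRat Φ) :
    ((n • M : endAlgRat Φ) : Matrix ι ι ℚ) = (n : ℚ) • (M : Matrix ι ι ℚ) := by
  rw [Int.cast_smul_eq_zsmul]
  rfl

/-- `(d · 1_X)_ℚ = d · 1` for an integer `d`. [folklore] -/
private theorem map_intCast_coe_intCast_aux5 (d : ℤ) :
    (((d : endRingInt Φ) : Matrix ι ι ℤ)).map (Int.cast : ℤ → ℚ) = (d : ℚ) • (1 : Matrix ι ι ℚ) := by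
  rw [SubringClass.coe_intCast, Matrix.map_intCast Int.cast_zero, Int.cast_id, ← Matrix.smul_one_eq_diagonal]

/-- `det (d · 1_X) = d^{#ι} ≠ 0` for `d ≠ 0`. [folklore] -/
private theorem det_coe_intCast_ne_zero_aux5 {d : ℤ} (hd : d ≠ 0) :
    ((d : endRingInt Φ) : Matrix ι ι ℤ).det ≠ 0 := by
  rw [SubringClass.coe_intCast, ← Int.smul_one_eq_cast, Matrix.det_smul, Matrix.det_one, mul_one]
  exact pow_ne_zero _ hd

/-! ## §1 The ideal `I` inside `End⁰(X)` -/

section IdealSubmodule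

/-- **`I ⊆ End(X) ⊆ End⁰(X)` as a `ℤ`-submodule of `End⁰(X)`** ("ideals, seen inside the endomorphism
algebra"): the image of the left ideal `I` under `End(X) ↪ End⁰(X)` (`endToEndAlgRat`).
[cite: Kieffer2024IsogenyGraphs, §1.4.1 (standing convention: "lattices … namely endomorphism rings and ideals, seen inside the endomorphism algebra"), p. 43] -/
def idealSubmodule (I : Ideal (endRingInt Φ)) : Submodule ℤ (endAlgRat Φ) :=
  (I.restrictScalars ℤ).map (endToEndAlgRat Φ).toAddMonoidHom.toIntLinearMap

/-- Membership in `idealSubmodule`: being `σ_ℚ` for some `σ ∈ I`. [cite: Kieffer2024IsogenyGraphs, §1.4.1, p. 43] -/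
theorem mem_idealSubmodule_iff {I : Ideal (endRingInt Φ)} {M : endAlgRat Φ} :
    M ∈ idealSubmodule Φ I ↔ ∃ σ ∈ I, (σ : Matrix ι ι ℤ).map (Int.cast : ℤ → ℚ) = (M : Matrix ι ι ℚ) := by
  rw [idealSubmodule, Submodule.mem_map]
  constructor
  · rintro ⟨σ, hσ, rfl⟩
    exact ⟨σ, hσ, rfl⟩
  · rintro ⟨σ, hσ, h⟩
    exact ⟨σ, hσ, Subtype.ext h⟩

/-- `σ_ℚ ∈ I_ℚ ↔ σ ∈ I`. [cite: Kieffer2024IsogenyGraphs, §1.4.1, p. 43] -/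
theorem endToEndAlgRat_mem_idealSubmodule_iff {I : Ideal (endRingInt Φ)} {σ : endRingInt Φ} :
    endToEndAlgRat Φ σ ∈ idealSubmodule Φ I ↔ σ ∈ I := by
  rw [mem_idealSubmodule_iff]
  constructor
  · rintro ⟨τ, hτ, hτσ⟩
    rwa [← endToEndAlgRat_injective Φ (Subtype.ext hτσ)]
  · exact fun h ↦ ⟨σ, h, rfl⟩

/-- `idealSubmodule` and `idealRat` (`ComplexTorusKernelIdealEquivalence`) are the same subset of `M_ι(ℚ)`.
[cite: Kieffer2024IsogenyGraphs, §1.4.1, pp. 43, 45] -/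
theorem coe_mem_idealRat_iff_mem_idealSubmodule {I : Ideal (endRingInt Φ)} {M : endAlgRat Φ} :
    (M : Matrix ι ι ℚ) ∈ idealRat Φ I ↔ M ∈ idealSubmodule Φ I := by
  rw [mem_idealRat_iff, mem_idealSubmodule_iff]

/-- `I ↦ I_ℚ` is monotone. [cite: Kieffer2024IsogenyGraphs, §1.4.1, p. 43] -/
theorem idealSubmodule_mono : Monotone (idealSubmodule Φ) := fun _ _ h ↦
  Submodule.map_mono fun _ hσ ↦ h hσ

/-- `End(X)_ℚ` is the image of the trivial ideal: `idealSubmodule Φ ⊤ = endSubmodule Φ`.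
[cite: Kieffer2024IsogenyGraphs, §1.4.1, p. 43] -/
@[simp] theorem idealSubmodule_top : idealSubmodule Φ (⊤ : Ideal (endRingInt Φ)) = endSubmodule Φ := by
  ext M
  rw [mem_idealSubmodule_iff, mem_endSubmodule_iff]
  exact ⟨fun ⟨σ, _, h⟩ ↦ ⟨σ, h⟩, fun ⟨σ, h⟩ ↦ ⟨σ, Submodule.mem_top, h⟩⟩

/-- `I_ℚ ⊆ End(X)_ℚ`. [cite: Kieffer2024IsogenyGraphs, §1.4.1, p. 43] -/
theorem idealSubmodule_le_endSubmodule (I : Ideal (endRingInt Φ)) : idealSubmodule Φ I ≤ endSubmodule Φ := by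
  rw [← idealSubmodule_top]
  exact idealSubmodule_mono Φ le_top

/-- Every ideal of `End(X)` is finitely generated over `ℤ` (`End(X) ≅ ℤ^m` is noetherian), so `I_ℚ` is a
finitely generated `ℤ`-module — the first half of "lattice". [cite: Kieffer2024IsogenyGraphs, §1.4.1, p. 43]
[cite: Lange2023AbelianVarietiesComplex, §1.1.2 Prop. 1.1.8, p. 22] -/
theorem fg_idealSubmodule (I : Ideal (endRingInt Φ)) : (idealSubmodule Φ I).FG := by
  haveI : IsNoetherian ℤ (endRingInt Φ) := isNoetherian_of_isNoetherianRing_of_finite ℤ _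
  exact (IsNoetherian.noetherian (I.restrictScalars ℤ)).map _

/-- `I_ℚ` is a left `End(X)`-submodule: `End(X)_ℚ · I_ℚ ⊆ I_ℚ`. [cite: Kieffer2024IsogenyGraphs, §1.4.1 ("`I` is a *left* ideal"), p. 43] -/
theorem mul_mem_idealSubmodule {I : Ideal (endRingInt Φ)} {a m : endAlgRat Φ} (ha : a ∈ endSubmodule Φ)
    (hm : m ∈ idealSubmodule Φ I) : a * m ∈ idealSubmodule Φ I := by
  obtain ⟨β, hβ⟩ := (mem_endSubmodule_iff Φ).1 ha
  obtain ⟨σ, hσ, hσm⟩ := (mem_idealSubmodule_iff Φ).1 hm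
  refine (mem_idealSubmodule_iff Φ).2 ⟨β * σ, I.mul_mem_left β hσ, ?_⟩
  rw [Subring.coe_mul, map_intCast_mul_rat_aux5, hβ, hσm, Subalgebra.coe_mul]

end IdealSubmodule

/-! ## §2 Integers versus isogenies in `I` -/

section Integers

variable {Φ}

/-- **An ideal containing an isogeny contains a non-zero integer**: if `α ∈ I` is an isogeny of exponent
`e ≥ 1`, its quasi-inverse `g ∈ End(X)` (Prop. 1.1.15, `g α = e_X`) gives `e · 1_X = g α ∈ I`.
[cite: Kieffer2024IsogenyGraphs, §1.4.1 (standing convention), p. 43]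
[cite: Lange2023AbelianVarietiesComplex, §1.1.2 Prop. 1.1.15] -/
theorem exists_intCast_mem_of_mem {I : Ideal (endRingInt Φ)} {α : endRingInt Φ} (hα : α ∈ I)
    (hdet : (α : Matrix ι ι ℤ).det ≠ 0) : ∃ d : ℤ, d ≠ 0 ∧ (d : endRingInt Φ) ∈ I := by
  have hiso : IsIsogeny Φ Φ (α : Matrix ι ι ℤ) := isIsogeny_of_mem_endRingInt Φ α.2 hdet
  obtain ⟨B, hB, hBA, -⟩ := hiso.exists_quasiInverse
  refine ⟨(AddMonoid.exponent (mapMatrixHom Φ Φ (α : Matrix ι ι ℤ)).ker : ℤ),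
    Int.natCast_ne_zero.2 hiso.exponent_ker_pos.ne', ?_⟩
  have h : (⟨B, hB.mem_endRingInt Φ⟩ : endRingInt Φ) * α =
      ((AddMonoid.exponent (mapMatrixHom Φ Φ (α : Matrix ι ι ℤ)).ker : ℤ) : endRingInt Φ) := by
    apply Subtype.ext
    rw [Subring.coe_mul, SubringClass.coe_intCast, ← Int.smul_one_eq_cast]
    exact hBA
  rw [← h]
  exact I.mul_mem_left _ hα

/-- **`I` contains a non-zero integer iff `I` contains an isogeny.** [cite: Kieffer2024IsogenyGraphs, §1.4.1 (standing convention: "equivalent to requiring that `I` contains an isogeny"), p. 43] -/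
theorem exists_intCast_mem_iff {I : Ideal (endRingInt Φ)} :
    (∃ d : ℤ, d ≠ 0 ∧ (d : endRingInt Φ) ∈ I) ↔ ∃ α ∈ I, (α : Matrix ι ι ℤ).det ≠ 0 :=
  ⟨fun ⟨_, hd, hdI⟩ ↦ ⟨_, hdI, det_coe_intCast_ne_zero_aux5 Φ hd⟩,
    fun ⟨_, hα, hdet⟩ ↦ exists_intCast_mem_of_mem hα hdet⟩

end Integers

/-! ## §3 Lattice ideals -/

section Lattice

variable {Φ}

/-- **"`I` is also a lattice in `End(A)` (i.e. it has full rank over `ℤ`). This is equivalent to requiring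
that `I` contains an isogeny."**  (`⟹`: full rank gives `n · 1_X ∈ I_ℚ` for some `n ≠ 0`, i.e. the isogeny
`[n] ∈ I`; `⟸`: with the integer `d ∈ I` of §2 and `End(X)` a full lattice, `(dn) M = (β d)_ℚ ∈ I_ℚ` whenever
`n M = β_ℚ ∈ End(X)_ℚ`.) [cite: Kieffer2024IsogenyGraphs, §1.4.1 (standing convention before Def. 1.4.1), p. 43] -/
theorem isFullLattice_idealSubmodule_iff {I : Ideal (endRingInt Φ)} :
    IsFullLattice (endAlgRat Φ) (idealSubmodule Φ I) ↔ ∃ α ∈ I, (α : Matrix ι ι ℤ).det ≠ 0 := by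
  rw [← exists_intCast_mem_iff]
  constructor
  · rintro ⟨-, h⟩
    obtain ⟨n, hn, h1⟩ := h 1
    obtain ⟨σ, hσ, hσ1⟩ := (mem_idealSubmodule_iff Φ).1 h1
    refine ⟨n, hn, ?_⟩
    have hσn : σ = (n : endRingInt Φ) := by
      apply Subtype.ext
      apply Matrix.map_injective (Int.cast_injective (α := ℚ))
      change (σ : Matrix ι ι ℤ).map (Int.cast : ℤ → ℚ) = ((n : endRingInt Φ) : Matrix ι ι ℤ).map (Int.cast : ℤ → ℚ)
      rw [hσ1, map_intCast_coe_intCast_aux5, coe_zsmul_endAlgRat_aux5, OneMemClass.coe_one]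
    rwa [← hσn]
  · rintro ⟨d, hd, hdI⟩
    refine ⟨fg_idealSubmodule Φ I, fun M ↦ ?_⟩
    obtain ⟨n, hn, hnM⟩ := exists_zsmul_mem_endSubmodule Φ M
    obtain ⟨β, hβ⟩ := (mem_endSubmodule_iff Φ).1 hnM
    refine ⟨d * n, mul_ne_zero hd hn, (mem_idealSubmodule_iff Φ).2 ⟨β * d, I.mul_mem_left β hdI, ?_⟩⟩
    rw [Subring.coe_mul, map_intCast_mul_rat_aux5, hβ, map_intCast_coe_intCast_aux5, coe_zsmul_endAlgRat_aux5,
      coe_zsmul_endAlgRat_aux5, Matrix.mul_smul, Matrix.mul_one, smul_smul, Int.cast_mul, mul_comm]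

/-- **"When `A` is simple, this just means `I ≠ {0}`"**: for a simple torus every non-zero endomorphism is an
isogeny. [cite: Kieffer2024IsogenyGraphs, §1.4.1 (standing convention), p. 43]
[cite: Lange2023AbelianVarietiesComplex, §2.4.4 Cor. 2.4.26 (proof), p. 124] -/
theorem isFullLattice_idealSubmodule_iff_ne_bot [Nonempty ι] (hX : IsSimple Φ) {I : Ideal (endRingInt Φ)} :
    IsFullLattice (endAlgRat Φ) (idealSubmodule Φ I) ↔ I ≠ ⊥ := by
  rw [isFullLattice_idealSubmodule_iff]
  constructor
  · rintro ⟨α, hα, hdet⟩ rfl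
    rw [(Submodule.mem_bot (endRingInt Φ)).1 hα, ZeroMemClass.coe_zero, Matrix.det_zero] at hdet
    exact hdet rfl
  · intro hI
    obtain ⟨σ, hσ, hσ0⟩ := I.ne_bot_iff.1 hI
    have hσ0' : (σ : Matrix ι ι ℤ) ≠ 0 := fun h ↦ hσ0 (Subtype.ext h)
    exact ⟨σ, hσ, ((isIsogeny_iff_det_ne_zero Φ Φ _).1
      (hX.isIsogeny_of_ne_zero ((mem_endRingInt_iff Φ).1 σ.2) hσ0')).2⟩

/-- An ideal containing a lattice ideal is a lattice. [cite: Kieffer2024IsogenyGraphs, §1.4.1, p. 43] -/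
theorem isFullLattice_idealSubmodule_mono {I J : Ideal (endRingInt Φ)} (hIJ : I ≤ J)
    (hI : IsFullLattice (endAlgRat Φ) (idealSubmodule Φ I)) : IsFullLattice (endAlgRat Φ) (idealSubmodule Φ J) := by
  obtain ⟨α, hα, hdet⟩ := isFullLattice_idealSubmodule_iff.1 hI
  exact isFullLattice_idealSubmodule_iff.2 ⟨α, hIJ hα, hdet⟩

/-- **`H(I)` is finite for a lattice ideal `I`** ("it is a finite subgroup scheme of `A`": `H(I) ⊆ ker α` for
the isogeny `α ∈ I`). [cite: Kieffer2024IsogenyGraphs, §1.4.1 Def. 1.4.1, p. 43] -/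
theorem finite_kernelSubgroup_of_isFullLattice {I : Ideal (endRingInt Φ)}
    (hI : IsFullLattice (endAlgRat Φ) (idealSubmodule Φ I)) : Finite (kernelSubgroup Φ I) := by
  obtain ⟨α, hα, hdet⟩ := isFullLattice_idealSubmodule_iff.1 hI
  exact finite_kernelSubgroup_of_mem Φ hα hdet

end Lattice

/-! ## §4 Kernel ideals of finite subgroups, principal ideals of isogenies, invertible ideals -/

section Examples

/-- **`#K · 1_X ∈ I(K)`** for a finite subgroup `K ⊆ X` (Lagrange: `#K` kills `K`).
[cite: Kieffer2024IsogenyGraphs, §1.4.1 (the ideal `{α ∈ End(A) : K ⊂ ker(α)}` of a finite subgroup scheme `K`), p. 43] -/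
theorem natCard_mem_idealOfSubgroup (K : AddSubgroup (ComplexTorus Φ)) [Finite K] :
    ((Nat.card K : ℤ) : endRingInt Φ) ∈ idealOfSubgroup Φ K := by
  rw [mem_idealOfSubgroup_iff]
  intro t ht
  show mapMatrix Φ Φ (((Nat.card K : ℤ) : endRingInt Φ) : Matrix ι ι ℤ) t = 0
  rw [SubringClass.coe_intCast, ← Int.smul_one_eq_cast, mapMatrix_smul, mapMatrix_one, natCast_zsmul]
  have h : ((Nat.card K • (⟨t, ht⟩ : K) : K) : ComplexTorus Φ) = 0 := by
    rw [card_nsmul_eq_zero', ZeroMemClass.coe_zero]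
  rwa [AddSubmonoidClass.coe_nsmul] at h

/-- The kernel ideal `I(K)` of a finite subgroup is a lattice. [cite: Kieffer2024IsogenyGraphs, §1.4.1, p. 43] -/
theorem isFullLattice_idealSubmodule_idealOfSubgroup (K : AddSubgroup (ComplexTorus Φ)) [Finite K] :
    IsFullLattice (endAlgRat Φ) (idealSubmodule Φ (idealOfSubgroup Φ K)) := by
  haveI : Nonempty K := ⟨0⟩
  exact isFullLattice_idealSubmodule_iff.2 (exists_intCast_mem_iff.1
    ⟨_, Int.natCast_ne_zero.2 Nat.card_pos.ne', natCard_mem_idealOfSubgroup Φ K⟩)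

variable {Φ}

/-- **A kernel ideal is a lattice iff `H(I)` is finite** (`I = I(H(I)) ∋ #H(I) · 1_X`).
[cite: Kieffer2024IsogenyGraphs, §1.4.1 Def. 1.4.1 and Def. 1.4.2, p. 43] -/
theorem IsKernelIdeal.isFullLattice_idealSubmodule_iff_finite {I : Ideal (endRingInt Φ)} (hI : IsKernelIdeal Φ I) :
    IsFullLattice (endAlgRat Φ) (idealSubmodule Φ I) ↔ Finite (kernelSubgroup Φ I) := by
  refine ⟨finite_kernelSubgroup_of_isFullLattice, fun _ ↦ ?_⟩
  rw [← hI]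
  exact isFullLattice_idealSubmodule_idealOfSubgroup Φ _

variable (Φ) in
/-- The trivial ideal `End(X)` is a lattice (`1_X` is an isogeny). [cite: Kieffer2024IsogenyGraphs, §1.4.1, p. 43] -/
theorem isFullLattice_idealSubmodule_top : IsFullLattice (endAlgRat Φ) (idealSubmodule Φ (⊤ : Ideal (endRingInt Φ))) :=
  isFullLattice_idealSubmodule_iff.2 ⟨1, Submodule.mem_top, by
    rw [OneMemClass.coe_one, Matrix.det_one]; exact one_ne_zero⟩

/-- **A principal ideal `End(X)α` of an isogeny `α` is a lattice** ("if `I` is a principal ideal of the form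
`End(A)α` …"). [cite: Kieffer2024IsogenyGraphs, §1.4.1 (after Def. 1.4.1), p. 43] -/
theorem isFullLattice_idealSubmodule_span_singleton {α : endRingInt Φ} (hα : (α : Matrix ι ι ℤ).det ≠ 0) :
    IsFullLattice (endAlgRat Φ) (idealSubmodule Φ (Ideal.span {α})) :=
  isFullLattice_idealSubmodule_iff.2 ⟨α, Ideal.mem_span_singleton_self α, hα⟩

/-- **Invertible ideals are lattices** (they contain the integer `d` of
`IsInvertibleIdeal.exists_intCast_mem`). [cite: Kieffer2024IsogenyGraphs, §1.4.1 (p. 43) and §1.4.3 (sketch of proof of Theorem 2: "Let `I` be an invertible ideal in `R`"), p. 47] -/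
theorem IsInvertibleIdeal.isFullLattice_idealSubmodule {I : Ideal (endRingInt Φ)} (hI : IsInvertibleIdeal Φ I) :
    IsFullLattice (endAlgRat Φ) (idealSubmodule Φ I) :=
  isFullLattice_idealSubmodule_iff.2 (exists_intCast_mem_iff.1 hI.exists_intCast_mem)

end Examples

end ComplexTorus

end Literature.Geometry.Kaehler
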